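import Summits.HubbardSuperconductivity.HubbardSuperconductivity.Theorems.AnisotropyChordTransferFibre3ManifoldBand
import Summits.HubbardSuperconductivity.HubbardSuperconductivity.Theorems.AnisotropyChordTransferFibre3NuRange

/-!
# Route `AnisotropyChord` / H0 rotor rung: family A of the LEVEL-2 certificate on the t-BLOCKS — the ν-ceiling, the manifold
band and the second-shell window for `L ≥ 64` (and the ceiling for `L ≥ 96`)

`…Fibre3ManifoldA` / `…ManifoldBand` prove the family-A inputs of the Level-2 rows (`nu_ceiling`: `λ₂ < .031θ²`,
`manifold_band`, `second_shell_window`: `±.001`) for `L ≥ 128` only, although their analytic inputs hold from `L ≥ 64`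
(`CapacityConst.capacity_const_bounds`, `capacity_KT_bounds`, `lamPart_KT_le`: `64 ≤ L`; `Subsample.dev_*`: `12 ≤ L`;
`manifold_dictionary`: `5 ≤ L`; `nu_le_of_ge_31`: `31 ≤ L`).  For the t-blocks `[64,96)`, `[96,128)` of the range
`48 ≤ L < 128` (route-lead ruling R1; inventory memo HOME/hubbard-h0-rotor-p2/TBLOCK-INVENTORY-g8.md) this file re-derives
them at the block floors, SAME proofs with the block numerics (`V ≥ 4096`, `ln L ≥ 4.1588`, `ln x/x² ≤ 4.1589/4096`):
* `log_64_ge/le`, `log_96_ge`, `log_div_sq_le64`;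
* ★ `nu_ceiling64`: `λ₂ < 0.0359·θ²` (`L ≥ 64`; `G̃₀(0) ≥ ln 64/2π + .0456 ≥ .7074`), ★ `nu_ceiling96`: `λ₂ < 0.0329·θ²` (`L ≥ 96`);
* ★ `manifold_band64`: the four-sided band of `manifold_band`, verbatim, for `L ≥ 64`;
* ★ `second_shell_window64`: `|a_λ(1,1) − 1/π| ≤ 0.0012`, `|a_λ(2,0) − (1 − 2/π)| ≤ 0.003` for `L ≥ 64`, `0 ≤ ν ≤ .0513`.
Prover seat `hubbard-h0-rotor-p2` g8; helper for piece A = stmt-HubbardSuperconductivity-23918 of rung 19089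
(`--supports`, helper class).  WHAT THIS IS NOT: nothing here proves superconductivity in the Hubbard model; family-A inputs of
ONE conditional reduction (the GM₃ ∀L certificate) on the t-blocks; the rotor TARGET as originally worded stays FALSE (g15
verdict).  Tree imports only; no new definitions; no sorry.
-/

set_option linter.dupNamespace false
set_option autoImplicit false

noncomputable section

open scoped BigOperators

namespace Summit.HubbardSuperconductivity.HubbardSuperconductivity.Theorems.AnisotropyChord.Transfer.Fibre3

namespace ManifoldA

variable (L : ℕ) [NeZero L]

/-! ## Block numerics -/

/-- `ln 64 ≥ 4.1588`. [folklore] -/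
theorem log_64_ge : (4.1588 : ℝ) ≤ Real.log 64 := by
  have h : Real.log 64 = 6 * Real.log 2 := by
    rw [show (64 : ℝ) = 2 ^ 6 by norm_num, Real.log_pow]; norm_num
  rw [h]; linarith [Real.log_two_gt_d9]

/-- `ln 64 ≤ 4.1589`. [folklore] -/
theorem log_64_le : Real.log 64 ≤ 4.1589 := by
  have h : Real.log 64 = 6 * Real.log 2 := by
    rw [show (64 : ℝ) = 2 ^ 6 by norm_num, Real.log_pow]; norm_num
  rw [h]; linarith [Real.log_two_lt_d9]

/-- `ln 96 ≥ 4.5643`. [folklore] -/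
theorem log_96_ge : (4.5643 : ℝ) ≤ Real.log 96 := by
  have h : Real.log 96 = 5 * Real.log 2 + Real.log 3 := by
    rw [show (96 : ℝ) = 2 ^ 5 * 3 by norm_num, Real.log_mul (by norm_num) (by norm_num), Real.log_pow]; norm_num
  rw [h]; linarith [Real.log_two_gt_d9, Real.log_three_gt_d9]

/-- `ln x/x² ≤ ln 64/64²` for `x ≥ 64` (concavity of `ln`). [folklore] -/
theorem log_div_sq_le64 (x : ℝ) (hx : 64 ≤ x) : Real.log x / x ^ 2 ≤ 4.1589 / 4096 := by
  have hx0 : 0 < x := by linarith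
  have h := Real.log_le_sub_one_of_pos (show (0 : ℝ) < x / 64 by positivity)
  rw [Real.log_div hx0.ne' (by norm_num)] at h
  have hlog : Real.log x ≤ 4.1589 + (x / 64 - 1) := by linarith [log_64_le]
  rw [div_le_iff₀ (by positivity)]
  nlinarith [mul_nonneg (sub_nonneg.mpr hx) (sub_nonneg.mpr hx)]

/-! ## The ν-ceilings of the blocks -/

/-- ★ ν-CEILING at `L ≥ 64`: `λ₂ < 0.0359·θ²` for a ground profile with `0 ≤ Δ` (`G̃₀(0) ≥ ln 64/2π + 0.0456 ≥ 0.7074`,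
`λ₂ ≤ 1/(V·G̃₀(0))`). [folklore] -/
theorem nu_ceiling64 (hL : 64 ≤ L) {Δ lam2 : ℝ} (hΔ0 : 0 ≤ Δ) {f : Tor L → ℝ}
    (hf : IsGroundTwoMagnon L Δ lam2 f) : lam2 < 0.0359 * (2 * Real.pi / L) ^ 2 := by
  have hπlo := Real.pi_gt_d6
  have hπhi := Real.pi_lt_d6
  have hL0 : (0 : ℝ) < L := by exact_mod_cast (show 0 < L by omega)
  have hL64 : (64 : ℝ) ≤ L := by exact_mod_cast hL
  have hV : (0 : ℝ) < (L : ℝ) ^ 2 := by positivity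
  have h1 := lam2_le_inv_Gres L (by omega) hΔ0 hf
  have hG := (CapacityConst.capacity_const_bounds L (by omega)).1
  have hlog : Real.log 64 ≤ Real.log L := Real.log_le_log (by norm_num) hL64
  have hG2 : 0.7074 ≤ Gres L 0 0 := by
    have h2π : 0 < 2 * Real.pi := by positivity
    have : 0.6618 ≤ Real.log L / (2 * Real.pi) := by
      rw [le_div_iff₀ h2π]; nlinarith [log_64_ge]
    linarith
  have hGpos : 0 < Gres L 0 0 := by linarith
  calc lam2 ≤ 1 / ((L : ℝ) ^ 2 * Gres L 0 0) := h1
    _ ≤ 1 / ((L : ℝ) ^ 2 * 0.7074) := by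
        apply one_div_le_one_div_of_le (by positivity)
        exact mul_le_mul_of_nonneg_left hG2 hV.le
    _ < 0.0359 * (2 * Real.pi / L) ^ 2 := by
        rw [div_lt_iff₀ (by positivity)]
        have e : 0.0359 * (2 * Real.pi / L) ^ 2 * ((L : ℝ) ^ 2 * 0.7074) = 0.0359 * 0.7074 * 4 * Real.pi ^ 2 := by
          field_simp; ring
        rw [e]; nlinarith

/-- ★ ν-CEILING at `L ≥ 96`: `λ₂ < 0.0329·θ²` (`G̃₀(0) ≥ ln 96/2π + 0.0456 ≥ 0.7720`). [folklore] -/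
theorem nu_ceiling96 (hL : 96 ≤ L) {Δ lam2 : ℝ} (hΔ0 : 0 ≤ Δ) {f : Tor L → ℝ}
    (hf : IsGroundTwoMagnon L Δ lam2 f) : lam2 < 0.0329 * (2 * Real.pi / L) ^ 2 := by
  have hπlo := Real.pi_gt_d6
  have hπhi := Real.pi_lt_d6
  have hL0 : (0 : ℝ) < L := by exact_mod_cast (show 0 < L by omega)
  have hL96 : (96 : ℝ) ≤ L := by exact_mod_cast hL
  have hV : (0 : ℝ) < (L : ℝ) ^ 2 := by positivity
  have h1 := lam2_le_inv_Gres L (by omega) hΔ0 hf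
  have hG := (CapacityConst.capacity_const_bounds L (by omega)).1
  have hlog : Real.log 96 ≤ Real.log L := Real.log_le_log (by norm_num) hL96
  have hG2 : 0.7720 ≤ Gres L 0 0 := by
    have h2π : 0 < 2 * Real.pi := by positivity
    have : 0.7264 ≤ Real.log L / (2 * Real.pi) := by
      rw [le_div_iff₀ h2π]; nlinarith [log_96_ge]
    linarith
  have hGpos : 0 < Gres L 0 0 := by linarith
  calc lam2 ≤ 1 / ((L : ℝ) ^ 2 * Gres L 0 0) := h1
    _ ≤ 1 / ((L : ℝ) ^ 2 * 0.7720) := by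
        apply one_div_le_one_div_of_le (by positivity)
        exact mul_le_mul_of_nonneg_left hG2 hV.le
    _ < 0.0329 * (2 * Real.pi / L) ^ 2 := by
        rw [div_lt_iff₀ (by positivity)]
        have e : 0.0329 * (2 * Real.pi / L) ^ 2 * ((L : ℝ) ^ 2 * 0.7720) = 0.0329 * 0.7720 * 4 * Real.pi ^ 2 := by
          field_simp; ring
        rw [e]; nlinarith

/-! ## The manifold band for `L ≥ 64` -/

/-- ★ THE MANIFOLD BAND at `L ≥ 64` (statement of `manifold_band`, verbatim): `0 ≤ a`, `a(1 − 1/V) < 1`,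
`1 − 4η gL⁺ (1 + 1/V) ≤ a`, `a(V − 1) ≤ V(1 − 4η gL⁻)` with `gL⁻ = ln L/2π + 0.0456 + 0.1266ν`,
`gL⁺ = ln L/2π + 0.0510 + 0.234ν` (manifold equation + `capacity_KT_bounds` (`L ≥ 64`) + `nu_le_of_ge_31`). [folklore] -/
theorem manifold_band64 (hL : 64 ≤ L) {Δ lam2 : ℝ} (hΔ0 : 0 ≤ Δ) (hΔ1 : Δ < 1) {f : Tor L → ℝ}
    (hf : IsGroundTwoMagnon L Δ lam2 f) :
    0 ≤ Δ * f (K1 L) ∧ Δ * f (K1 L) * (1 - 1 / (L : ℝ) ^ 2) < 1 ∧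
    1 - 4 * etaEff L lam2 * (Real.log L / (2 * Real.pi) + 0.0510 + 0.234 * (lam2 / (2 * Real.pi / L) ^ 2))
        * (1 + 1 / (L : ℝ) ^ 2) ≤ Δ * f (K1 L) ∧
    Δ * f (K1 L) * ((L : ℝ) ^ 2 - 1)
      ≤ (L : ℝ) ^ 2 * (1 - 4 * etaEff L lam2 * (Real.log L / (2 * Real.pi) + 0.0456 + 0.1266 * (lam2 / (2 * Real.pi / L) ^ 2))) := by
  have hπ := Real.pi_pos
  have hL5 : 5 ≤ L := by omega
  have hL0 : (0 : ℝ) < L := by exact_mod_cast (show 0 < L by omega)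
  have hL64 : (64 : ℝ) ≤ L := by exact_mod_cast hL
  have hV : (0 : ℝ) < (L : ℝ) ^ 2 := by positivity
  have hV1 : (1 : ℝ) ≤ (L : ℝ) ^ 2 := by nlinarith
  have hVbig : (4096 : ℝ) ≤ (L : ℝ) ^ 2 := by nlinarith
  obtain ⟨_, h2, _, _, h5, _, _⟩ := manifold_dictionary L hL5 hΔ0 hΔ1 hf
  have hME := manifold_equation L hL5 hΔ0 hΔ1 hf
  have hfpos : 0 < f (K1 L) := hf.1.2.2.1
  have hpos := lam2_pos L (by omega) hΔ1 hf.1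
  have hη0 : 0 < etaEff L lam2 := by unfold etaEff; positivity
  -- the capacity bracket (`ν ≤ 0.0513 ≤ 0.07` by `nu_le_of_ge_31`)
  have hθ2 : 0 < (2 * Real.pi / L) ^ 2 := by positivity
  set ν := lam2 / (2 * Real.pi / L) ^ 2 with hν
  have hνlam : ν * (2 * Real.pi / L) ^ 2 = lam2 := by rw [hν]; field_simp
  have hν0 : 0 ≤ ν := by positivity
  have hν7 : ν ≤ 0.07 := by
    rw [hν, div_le_iff₀ hθ2]; linarith [nu_le_of_ge_31 L (by omega) hΔ0 hf]
  obtain ⟨hClo, hChi⟩ := CapacityConst.capacity_KT_bounds L (by omega) ν hν0 hν7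
  rw [hνlam] at hClo hChi
  have hlog : 0 ≤ Real.log L / (2 * Real.pi) := by
    have : 0 ≤ Real.log L := Real.log_nonneg (by linarith)
    positivity
  set a := Δ * f (K1 L) with ha
  set η := etaEff L lam2
  set G := Gres L lam2 0
  have hG0 : 0 < G := by linarith
  have ha0 : 0 ≤ a := mul_nonneg hΔ0 hfpos.le
  have hcS : 0 < cS L Δ lam2 f := by rw [h2]; positivity
  refine ⟨ha0, ?_, ?_, ?_⟩
  · -- `a(1 − 1/V) < 1` from `c_s G̃ = 1 − a + a/V > 0`
    have : 0 < cS L Δ lam2 f * G := mul_pos hcS hG0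
    rw [h5] at this
    have e : a * (1 - 1 / (L : ℝ) ^ 2) = a - a / (L : ℝ) ^ 2 := by ring
    rw [e]; linarith
  · -- lower band
    set gp := Real.log L / (2 * Real.pi) + 0.0510 + 0.234 * ν with hgpdef
    have hgp : G ≤ gp := by linarith
    set y := 4 * η * gp with hy
    have hgp0 : 0 ≤ gp := le_trans hG0.le hgp
    have hy0 : 0 ≤ y := by positivity
    rcases le_or_gt y 1 with hy1 | hy1
    · have h3 : (L : ℝ) ^ 2 * (1 - a) + a ≤ y * ((L : ℝ) ^ 2 + a) := by
        rw [← hME, hy]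
        exact mul_le_mul_of_nonneg_right (mul_le_mul_of_nonneg_left hgp (by positivity)) (by positivity)
      have h4 : (L : ℝ) ^ 2 * (1 - y) ≤ a * ((L : ℝ) ^ 2 - 1 + y) := by linarith
      have key := lower_band_ineq y ((L : ℝ) ^ 2) hy0 hy1 hV1
      have hD : 0 < (L : ℝ) ^ 2 - 1 + y := by linarith
      exact le_of_mul_le_mul_right (key.trans h4) hD
    · have : 0 ≤ y * (1 / (L : ℝ) ^ 2) := by positivity
      have : 1 - y * (1 + 1 / (L : ℝ) ^ 2) < 0 := by nlinarith
      linarith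
  · -- upper band: `4η gm V ≤ 4η G (V + a) = V(1−a) + a`
    set gm := Real.log L / (2 * Real.pi) + 0.0456 + 0.1266 * ν with hgmdef
    have hgm : gm ≤ G := by linarith
    have e1 : 4 * η * gm * (L : ℝ) ^ 2 ≤ 4 * η * G * (L : ℝ) ^ 2 :=
      mul_le_mul_of_nonneg_right (mul_le_mul_of_nonneg_left hgm (by positivity)) hV.le
    have e2 : 4 * η * G * (L : ℝ) ^ 2 ≤ 4 * η * G * ((L : ℝ) ^ 2 + a) :=
      mul_le_mul_of_nonneg_left (by linarith) (by positivity)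
    have h3 : 4 * η * gm * (L : ℝ) ^ 2 ≤ (L : ℝ) ^ 2 * (1 - a) + a := by rw [← hME]; linarith
    linarith

/-! ## The second-shell window for `L ≥ 64` -/

/-- ★ SECOND-SHELL WINDOW at `L ≥ 64` (`0 ≤ ν ≤ 0.0513`, `λ = ν(2π/L)²`): `|a_λ(1,1) − 1/π| ≤ 0.0012` and
`|a_λ(2,0) − (1 − 2/π)| ≤ 0.003` (λ-parts `≤ 2ν·0.0087`, `≤ 4ν·0.0087`; `λ = 0` deviations `≤ 1/4096`, `4/4096`). [folklore] -/
theorem second_shell_window64 (hL : 64 ≤ L) (ν : ℝ) (hν0 : 0 ≤ ν) (hν : ν ≤ 0.0513) :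
    |aKer L (ν * (2 * Real.pi / L) ^ 2) ((((1 : ℤ)) : ZMod L), (((1 : ℤ)) : ZMod L)) - 1 / Real.pi| ≤ 0.0012 ∧
    |aKer L (ν * (2 * Real.pi / L) ^ 2) ((((2 : ℤ)) : ZMod L), (((0 : ℤ)) : ZMod L)) - (1 - 2 / Real.pi)| ≤ 0.003 := by
  have hL0 : (0 : ℝ) < L := by exact_mod_cast (show 0 < L by omega)
  have hL64 : (64 : ℝ) ≤ L := by exact_mod_cast hL
  have hV : (0 : ℝ) < (L : ℝ) ^ 2 := by positivity
  have hν7 : ν ≤ 0.07 := by linarith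
  have hlogq := log_div_sq_le64 (L : ℝ) hL64
  have hinv : 1 / (L : ℝ) ^ 2 ≤ 1 / 4096 := one_div_le_one_div_of_le (by norm_num) (by nlinarith)
  have hlog0 : 0 ≤ Real.log L := Real.log_nonneg (by linarith)
  -- λ-parts
  have hl11 := CapacityConst.lamPart_KT_le L (by omega) ν hν0 hν7 1 1
  have hl20 := CapacityConst.lamPart_KT_le L (by omega) ν hν0 hν7 2 0
  have hε : 0 < eps1 L := RateLemma.eps1_pos_of_two_le L (by omega)
  have hπlo := Real.pi_gt_d6
  have hπhi := Real.pi_lt_d6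
  have hlam0 : 0 ≤ ν * (2 * Real.pi / L) ^ 2 := by positivity
  have hlam1 : ν * (2 * Real.pi / L) ^ 2 < 2 * eps1 L := by
    have hεJ : 2 / Real.pi ^ 2 * (2 * Real.pi / L) ^ 2 ≤ eps1 L := RateLemma.eps1_ge_jordan L (by omega)
    have h1 : ν * (2 * Real.pi / L) ^ 2 < 4 / Real.pi ^ 2 * (2 * Real.pi / L) ^ 2 := by
      apply mul_lt_mul_of_pos_right _ (by positivity)
      rw [lt_div_iff₀ (by positivity)]; nlinarith
    have h2 : 4 / Real.pi ^ 2 * (2 * Real.pi / L) ^ 2 = 2 * (2 / Real.pi ^ 2 * (2 * Real.pi / L) ^ 2) := by ring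
    linarith
  have hp11 := (RateLemma.lamPartShellBound_holds L (by omega) _ hlam0 hlam1 ((((1 : ℤ)) : ZMod L), (((1 : ℤ)) : ZMod L))).1
  have hp20 := (RateLemma.lamPartShellBound_holds L (by omega) _ hlam0 hlam1 ((((2 : ℤ)) : ZMod L), (((0 : ℤ)) : ZMod L))).1
  -- λ = 0 deviations
  have hd11 := Subsample.dev_one_one L (by omega)
  have hd20 := Subsample.dev_two_zero L (by omega)
  rw [Subsample.aZ2_one_one] at hd11
  rw [Subsample.aZ2_two_zero'] at hd20
  obtain ⟨hd11a, hd11b⟩ := abs_le.mp hd11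
  obtain ⟨hd20a, hd20b⟩ := abs_le.mp hd20
  -- numeric sizes: `(7.76 ln L + 3.3)/L² ≤ 0.0087`
  have hsz : (7.76 * Real.log L + 3.3) / (L : ℝ) ^ 2 ≤ 0.0087 := by
    have e : (7.76 * Real.log L + 3.3) / (L : ℝ) ^ 2 = 7.76 * (Real.log L / (L : ℝ) ^ 2) + 3.3 * (1 / (L : ℝ) ^ 2) := by
      field_simp
    rw [e]; nlinarith
  have hl11' : RateLemma.lamPart L (ν * (2 * Real.pi / L) ^ 2) ((((1 : ℤ)) : ZMod L), (((1 : ℤ)) : ZMod L)) ≤ 0.0009 := by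
    refine hl11.trans ?_
    push_cast
    have e : ν * ((1 : ℝ) ^ 2 + (1 : ℝ) ^ 2) * (7.76 * Real.log L + 3.3) / (L : ℝ) ^ 2
        = 2 * ν * ((7.76 * Real.log L + 3.3) / (L : ℝ) ^ 2) := by ring
    rw [e]
    have h0 : 0 ≤ (7.76 * Real.log L + 3.3) / (L : ℝ) ^ 2 := by positivity
    have := mul_le_mul hν hsz h0 (by norm_num)
    linarith
  have hl20' : RateLemma.lamPart L (ν * (2 * Real.pi / L) ^ 2) ((((2 : ℤ)) : ZMod L), (((0 : ℤ)) : ZMod L)) ≤ 0.0018 := by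
    refine hl20.trans ?_
    push_cast
    have e : ν * ((2 : ℝ) ^ 2 + (0 : ℝ) ^ 2) * (7.76 * Real.log L + 3.3) / (L : ℝ) ^ 2
        = 4 * ν * ((7.76 * Real.log L + 3.3) / (L : ℝ) ^ 2) := by ring
    rw [e]
    have h0 : 0 ≤ (7.76 * Real.log L + 3.3) / (L : ℝ) ^ 2 := by positivity
    have := mul_le_mul hν hsz h0 (by norm_num)
    linarith
  have e11 : aKer L (ν * (2 * Real.pi / L) ^ 2) ((((1 : ℤ)) : ZMod L), (((1 : ℤ)) : ZMod L))
      = aKer L 0 ((((1 : ℤ)) : ZMod L), (((1 : ℤ)) : ZMod L))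
        + RateLemma.lamPart L (ν * (2 * Real.pi / L) ^ 2) ((((1 : ℤ)) : ZMod L), (((1 : ℤ)) : ZMod L)) := by
    unfold RateLemma.lamPart; ring
  have e20 : aKer L (ν * (2 * Real.pi / L) ^ 2) ((((2 : ℤ)) : ZMod L), (((0 : ℤ)) : ZMod L))
      = aKer L 0 ((((2 : ℤ)) : ZMod L), (((0 : ℤ)) : ZMod L))
        + RateLemma.lamPart L (ν * (2 * Real.pi / L) ^ 2) ((((2 : ℤ)) : ZMod L), (((0 : ℤ)) : ZMod L)) := by
    unfold RateLemma.lamPart; ring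
  have h4 : 4 / (L : ℝ) ^ 2 ≤ 4 / 4096 := by
    apply div_le_div_of_nonneg_left (by norm_num) (by norm_num) (by nlinarith)
  constructor
  · rw [e11, abs_le]; constructor <;> linarith only [hd11a, hd11b, hp11, hl11', hinv]
  · rw [e20, abs_le]; constructor <;> linarith only [hd20a, hd20b, hp20, hl20', h4]

end ManifoldA

end Summit.HubbardSuperconductivity.HubbardSuperconductivity.Theorems.AnisotropyChord.Transfer.Fibre3

end
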